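/- Width seat `ym-line-cbag-p1-w3` (prover-ym-line-cbag-p1-w3-g6-0), route `ColdBoxAllGroups`, crux `BoxFloorAllGroups`
(stmt-QuantumFields-22254, CLOSED proved): the one-scale expansion of the cold box for EVERY PAIR OF PLAQUETTES, every compact `G`, and
the cold-box Gaussian floor for the six-plane ACTION DENSITY. -/
import Summits.QuantumFields.YangMills.Theorems.ColdBoxAllGroupsBoxAllPairsCoreG
import Summits.QuantumFields.YangMills.Theorems.ColdBoxAllGroupsBoxFloorDimEPos

/-!
# Route `ColdBoxAllGroups`, BOX half for ALL PLAQUETTE PAIRS — part 2/2: the eventual assembly, Wick nonnegativity, and the cold-box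
# floor for the corner action density `Σ_{μ<ν} (N − Re tr ρ(U_{p_{μν}(x)}))`

The proved crux `BoxFloorAllGroups` (stmt-QuantumFields-22254) is the Gaussian floor of ONE covariance: the `(1,2)`-plaquette cost at the centre
of the cold-wall box `[0,2H]⁴`, `H = ⌈β^θ⌉`, against its translate by `⌈β^A⌉e₀` (`boxPlaqCov`).  This file proves the BOX-side one-scale
expansion for EVERY pair of plaquettes of the box and draws the consequences (every compact group `G` presented faithfully in `U(N)`,
any Borel structure; simplicity of `G` is idle, as in `ColdBoxAllGroupsBoxFloorDimEPos`):
* **`boxPairCovExpansion_of_rep`** (S2 for all pairs) — for `0 < θ ≤ 1/100`, eventually in `β`, for ALL plaquettes `P, Q` touching the box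
  (`plaquettesTouching (boxEdges 4 (2H+1))`):
  `|β²·Cov_{boxState ρ β H}(c_P, c_Q) − (D/4)·(E_D[s_P²s_Q²] − E_D[s_P²]E_D[s_Q²])| ≤ β^{−9θ}`, `D = dimE ρ`, `s_P = dirCirc H P` the
  temporal-gauge Dirichlet-Gaussian circulation — ONE threshold `β₀(ρ, θ)` for all pairs (the bricks B5-J, B4', ChartWindowG, B9c of the
  line are pair-free; B2/B9a are the all-pairs forms of part 1);
* **`boxPairCovExpansion_wick_of_rep`** — the same with the Gaussian term in Wick form `(D/2)·E_D[s_P s_Q]²` (`integral_dirCirc_sq_mul_sq_sub`),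
  hence **`boxPairCov_ge_of_rep`**: eventually `β²·Cov_box(c_P, c_Q) ≥ (D/2)·E_D[s_P s_Q]² − β^{−9θ} ≥ −β^{−9θ}` for ALL pairs — every
  two-plaquette covariance of the cold box (any two planes, any two positions) is nonnegative up to `β^{−2−9θ}`;
* **`boxActionDensityTwoPointDomination_of_dimE_pos`** — the cold-box Gaussian FLOOR for the CORNER ACTION DENSITY: for `0 < dimE ρ` and all
  `0 < A < θ ≤ 1/100` there is `c > 0` with, eventually in `β`,
  `c·C(⌈β^A⌉)² ≤ β²·Cov_{boxState ρ β ⌈β^θ⌉}(Σ_q c_{(x_c; q)}, Σ_q c_{(x_c + ⌈β^A⌉e₀; q)})`, the sums over the six planes `q = (μ < ν)`, `x_c` the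
  centre, `C(n) = curvaturePlaquetteCorr 4 n` — i.e. the BOX statement of the crux with the single `(1,2)`-plaquette replaced by the six-plane
  corner density `Σ_{μ<ν}(N − Re tr ρ(U_{p_{μν}(x)}))` (`= 6N − actionDensity` translated to `x`, cf. `actionDensity_eq_sum_subtype`; the
  species `r.curvature.F` of the node `LatticeNonFreezing`): the 36 plane pairs contribute `≥ −β^{−9θ}` each and the diagonal `(1,2)/(1,2)` pair
  contributes the crux's floor (`boxTwoPointDomination_of_dimE_pos`);
* **`boxActionDensityFloor_allGroups`** — the same for every compact simple `G` (tree sense) and every faithful unitary lattice representation,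
  in the binder shape of the crux (`D ≥ 1` by `dimE_pos_of_isCompactSimpleLieGroup`).
What this is for (planner note, INVENTORY §5.3 of the crux): the node `LatticeNonFreezing` as typed concerns the six-plane density; its BOX
half is this file; the BULK half (DLR + chessboard transfer of the 36 plane-pair covariances to the torus states) is NOT done here.
No sorry; no new definition; standard axioms.  NOT a claim about the Yang–Mills mass gap: rung-level support of a RECORD-label rung (R2xi-G);
no summit statement is touched.
-/

set_option autoImplicit false

noncomputable section

open MeasureTheory ProbabilityTheory Finset Real Filter Topology Metric
open Literature.Probability.LatticeModels (Site)
open Literature.MathematicalPhysics.QuantumLattice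
open Literature.MathematicalPhysics.QuantumFieldTheory
open Literature.MathematicalPhysics.QuantumFieldTheory.LatticeMaxwell
open Literature.MathematicalPhysics.QuantumFieldTheory.AxialGauge
open Summit.QuantumFields.YangMills.Theorems.WeakCouplingRates
open Summit.QuantumFields.YangMills.Theorems.FreeEnergyLogCoefficient

namespace Summit.QuantumFields.YangMills.Theorems.ColdBoxAllGroups

/-! ## S2 for all pairs: the eventual assembly -/

section Rep

variable {N : ℕ} {G : Type} [Group G] [TopologicalSpace G] [IsTopologicalGroup G] [CompactSpace G]
  [MeasurableSpace G] [BorelSpace G] (ρ : G →* Matrix (Fin N) (Fin N) ℂ)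

/-- **S2 for ALL plaquette pairs — the absolute one-scale comparison of every two-plaquette covariance of the cold-wall box with its
temporal-gauge Dirichlet Gaussian, for every compact group presented faithfully in `U(N)`.**  For a faithful continuous unitary
`ρ : G →* U(N)` and `0 < θ ≤ 1/100`: eventually in `β` (ONE threshold for all pairs), for all plaquettes `P, Q` touching the box of half-side
`H = ⌈β^θ⌉`, `|β²·Cov_{boxState ρ β H}(c_P, c_Q) − (D/4)·(E_D[s_P²s_Q²] − E_D[s_P²]E_D[s_Q²])| ≤ β^{−9θ}`, `D = dimE ρ`.  The proof is the
lead's assembly B9b verbatim (bricks B5-J, B4', ChartWindowG, B9c), fed with the all-pairs forms of B2 and B9a. -/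
theorem boxPairCovExpansion_of_rep (hρc : Continuous ρ) (hinj : Function.Injective ρ)
    (hρu : ∀ g, ρ g ∈ Matrix.unitaryGroup (Fin N) ℂ) {θ : ℝ} (hθ : 0 < θ) (hθ1 : θ ≤ 1 / 100) :
    ∃ β₀ : ℝ, ∀ β : ℝ, β₀ ≤ β → ∀ P Q : ZdPlaquette 4,
      P ∈ plaquettesTouching (boxEdges 4 (2 * ⌈β ^ θ⌉₊ + 1)) → Q ∈ plaquettesTouching (boxEdges 4 (2 * ⌈β ^ θ⌉₊ + 1)) →
      |β ^ 2 * ((∫ U, plaqCostAt ρ P.1 P.2.1.1 P.2.1.2 U * plaqCostAt ρ Q.1 Q.2.1.1 Q.2.1.2 U ∂(boxState ρ β ⌈β ^ θ⌉₊)) -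
            (∫ U, plaqCostAt ρ P.1 P.2.1.1 P.2.1.2 U ∂(boxState ρ β ⌈β ^ θ⌉₊)) *
              (∫ U, plaqCostAt ρ Q.1 Q.2.1.1 Q.2.1.2 U ∂(boxState ρ β ⌈β ^ θ⌉₊))) -
          (dimE ρ : ℝ) / 4 *
            ((∫ s, dirCirc ⌈β ^ θ⌉₊ (P.1, P.2.1.1, P.2.1.2) s ^ 2 * dirCirc ⌈β ^ θ⌉₊ (Q.1, Q.2.1.1, Q.2.1.2) s ^ 2
                ∂(boxDirichlet ⌈β ^ θ⌉₊)) -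
              (∫ s, dirCirc ⌈β ^ θ⌉₊ (P.1, P.2.1.1, P.2.1.2) s ^ 2 ∂(boxDirichlet ⌈β ^ θ⌉₊)) *
                (∫ s, dirCirc ⌈β ^ θ⌉₊ (Q.1, Q.2.1.1, Q.2.1.2) s ^ 2 ∂(boxDirichlet ⌈β ^ θ⌉₊)))| ≤ β ^ (-(9 * θ)) := by
  haveI : SecondCountableTopology (Matrix (Fin N) (Fin N) ℂ) := inferInstanceAs (SecondCountableTopology (Fin N → Fin N → ℂ))
  haveI : SecondCountableTopology G := (hρc.isClosedEmbedding hinj).isEmbedding.secondCountableTopology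
  -- the chart density (B5-J)
  obtain ⟨r₂, C₂, cH, hr₂, -, hC₂, hcH, J, hJc, hJb, hJhalf, hdens⟩ :=
    exists_chartMeasureE_restrict_closedBall_eq_withDensity ρ hρc hinj hρu
  -- eventual facts: the exponent window (B9c), the link window (ChartWindowG), the conditioning (B2, all pairs)
  have hwin5 : 2 * θ + 3 * θ < 1 / 2 := by linarith
  obtain ⟨β₁, hE⟩ := Filter.eventually_atTop.1 ((eventually_oneScale_boundsG N (dimE ρ) hθ hθ1 hr₂ hC₂).and
    (eventually_linkWindow_subset_image_expChart ρ hρc hinj hρu (ε := 3 * θ) hθ.le hwin5 one_pos))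
  obtain ⟨β₂, hcondE⟩ := abs_boxPairCov_sub_cond_le_of_rep ρ hρc hρu hθ (by linarith : 2 * θ < 3 * θ)
  obtain ⟨β₃, hG0E⟩ := boxState_coldGoodSetG_ne_zero ρ hρc hρu hθ (by linarith : 2 * θ < 3 * θ)
  refine ⟨max β₁ (max β₂ β₃), fun β hβ P Q hP hQ => ?_⟩
  have hb₁ : β₁ ≤ β := (le_max_left _ _).trans hβ
  have hb₂ : β₂ ≤ β := ((le_max_left _ _).trans (le_max_right _ _)).trans hβ
  have hb₃ : β₃ ≤ β := ((le_max_right _ _).trans (le_max_right _ _)).trans hβ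
  obtain ⟨⟨hβ1, hm4, hmr₂, hmEm, hwin, hp1, hfinal⟩, -, hball⟩ := hE β hb₁
  -- names for the one-scale quantities
  set H : ℕ := ⌈β ^ θ⌉₊ with hHdef
  set η : ℝ := (12 * (H : ℝ) ^ 2 + 2 * H + 1) * (Real.sqrt 2 * Real.sqrt (β ^ (2 * (3 * θ) - 1))) with hηdef
  set m : ℝ := 2 * η with hmdef
  set R : ℝ := β ^ (3 * θ) / (2 * (Real.sqrt (dimE ρ) + 1)) with hRdef
  set p : ℝ := 240 * (dimE ρ : ℝ) * (2 * (H : ℝ) + 1) ^ 4 * Real.exp (-R ^ 2 / 2) with hpdef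
  set ℓ : ℝ := 2 * C₂ * m ^ 2 with hℓdef
  have hβ0 : 0 < β := by linarith
  have hH : 1 ≤ H := by
    have := (one_le_ceil_rpow_and_le (A := θ) hβ1 hθ.le).1
    exact_mod_cast this
  have hη0 : 0 < η := by
    have : 0 < Real.sqrt (β ^ (2 * (3 * θ) - 1)) := Real.sqrt_pos.2 (Real.rpow_pos_of_pos hβ0 _)
    positivity
  have hm0 : 0 < m := by positivity
  have hℓ0 : 0 ≤ ℓ := by positivity
  have hR0 : 0 ≤ R := by positivity
  have hmE4 : Real.sqrt (dimE ρ) * ((12 * (H : ℝ) ^ 2 + 2 * H + 1) * R) / Real.sqrt β ≤ 1 / 4 := hmEm.trans hm4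
  -- the density hypotheses at radius `m`
  have hgpos : ∀ a : EuclideanSpace ℝ (Fin (dimE ρ)), ‖a‖ ≤ m → 0 < J a := fun a ha => by
    linarith [(hJhalf a (ha.trans hmr₂)).1]
  have hg : ∀ a : EuclideanSpace ℝ (Fin (dimE ρ)), ‖a‖ ≤ m → |Real.log (J a)| ≤ ℓ := fun a ha => by
    refine (abs_log_jacobian_le hJb hJhalf a (ha.trans hmr₂)).trans ?_
    rw [hℓdef]
    have : ‖a‖ ^ 2 ≤ m ^ 2 := pow_le_pow_left₀ (norm_nonneg _) ha 2
    nlinarith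
  have hc0 : ENNReal.ofReal cH ≠ 0 := by rw [ENNReal.ofReal_ne_zero_iff]; exact hcH
  have hdensm := hdens m hm0 hmr₂
  -- the two charged events
  have hG0 : boxState ρ β H (coldGoodSetG ρ H β (3 * θ)) ≠ 0 := hG0E β hb₃
  haveI : IsProbabilityMeasure (gaussD H (dimE ρ)) := isProbabilityMeasure_gaussD H (dimE ρ)
  have hSm : MeasurableSet (goodTE ρ H β (3 * θ) ∩ {t | ∀ e, ‖unscaleTE H (dimE ρ) β t e‖ ≤ m}) :=
    (measurableSet_goodTE ρ hρc hinj β (3 * θ)).inter (measurableSet_ball_unscaleTE (dimE ρ) β m)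
  have hpS : (gaussD H (dimE ρ)).real (goodTE ρ H β (3 * θ) ∩ {t | ∀ e, ‖unscaleTE H (dimE ρ) β t e‖ ≤ m})ᶜ ≤ p :=
    gaussD_real_compl_goodTE_inter_ball_le ρ hρc hβ0 hH hR0 hmE4 hmEm hwin
  have hγ : gaussD H (dimE ρ) (goodTE ρ H β (3 * θ) ∩ {t | ∀ e, ‖unscaleTE H (dimE ρ) β t e‖ ≤ m}) ≠ 0 :=
    measure_ne_zero_of_real_compl_lt_one _ hSm (hpS.trans_lt hp1)
  -- the representation (B4') at radius `m = 2η`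
  have hrep : ∀ X : LGConfig 4 G → ℝ, Measurable X → IsZdGaugeInvariant X → (∀ U, 0 ≤ X U) →
      ∫ U, X U ∂((boxState ρ β H)[|coldGoodSetG ρ H β (3 * θ)]) =
        ∫ t, X (cfgTE ρ H β t) ∂(((gaussD H (dimE ρ))[|(goodTE ρ H β (3 * θ) ∩ {t | ∀ e, ‖unscaleTE H (dimE ρ) β t e‖ ≤ m})]).tilted
          ((goodTE ρ H β (3 * θ) ∩ {t | ∀ e, ‖unscaleTE H (dimE ρ) β t e‖ ≤ m}).indicator (tiltWE ρ H J β))) :=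
    fun X hXm hXinv hX0 => integral_cond_boxState_eq_integral_tilted_G' ρ hρc hinj hρu hβ0 hH hm4 hball hJc.measurable hgpos hc0
      ENNReal.ofReal_ne_top hdensm hG0 hγ hXm hXinv hX0
  -- the deterministic core (B9a, all pairs)
  have hcore := abs_boxPairCov_sub_dirCircSqCov_le_coreG ρ hρc hinj hρu (ε := 3 * θ) (m := m) (ℓ := ℓ) (R := R) (p := p)
    (c₀ := 24 * (N : ℝ) ^ 2 * Real.exp (-(β ^ (3 * θ)))) hP hQ hJc.measurable hβ1 hH hm0.le hm4 hℓ0 hg hR0 hmE4 hmEm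
    hwin le_rfl hp1 hrep (hcondE β hb₂ P.1 Q.1 P.2.1.1 P.2.1.2 Q.2.1.1 Q.2.1.2)
  -- the final smallness (B9c): monotonicity in the tilt size, then `≤ β^{−9θ}`
  refine hcore.trans (le_trans ?_ hfinal)
  have hτ0 : 0 ≤ 190 * β * m ^ 3 := by positivity
  have hw := tiltSize_le_cardBound H hτ0 hℓ0
  have hexp : Real.exp (2 * ((#(plaquettesTouching (boxEdges 4 (2 * H + 1))) : ℝ) * (190 * β * m ^ 3) +
      (Fintype.card (ColdFreeIdx H) : ℝ) * ℓ)) ≤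
      Real.exp (2 * (120 * (2 * (H : ℝ) + 1) ^ 4 * (190 * β * m ^ 3) + 4 * (2 * (H : ℝ) + 1) ^ 4 * ℓ)) :=
    Real.exp_le_exp.2 (by linarith)
  have hM0 : 0 ≤ 3 * (β ^ (2 * (3 * θ))) ^ 2 := by positivity
  have key := mul_le_mul_of_nonneg_left (sub_le_sub_right hexp 1) hM0
  linarith [key]

/-- **S2 for all pairs in Wick form**: eventually in `β`, for all plaquettes `P, Q` touching the box `H = ⌈β^θ⌉`,
`|β²·Cov_{boxState ρ β H}(c_P, c_Q) − (D/2)·E_D[s_P s_Q]²| ≤ β^{−9θ}` (`E_D[s_P²s_Q²] − E_D[s_P²]E_D[s_Q²] = 2E_D[s_P s_Q]²`, Wick for the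
Dirichlet Gaussian, `integral_dirCirc_sq_mul_sq_sub`). -/
theorem boxPairCovExpansion_wick_of_rep (hρc : Continuous ρ) (hinj : Function.Injective ρ)
    (hρu : ∀ g, ρ g ∈ Matrix.unitaryGroup (Fin N) ℂ) {θ : ℝ} (hθ : 0 < θ) (hθ1 : θ ≤ 1 / 100) :
    ∃ β₀ : ℝ, ∀ β : ℝ, β₀ ≤ β → ∀ P Q : ZdPlaquette 4,
      P ∈ plaquettesTouching (boxEdges 4 (2 * ⌈β ^ θ⌉₊ + 1)) → Q ∈ plaquettesTouching (boxEdges 4 (2 * ⌈β ^ θ⌉₊ + 1)) →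
      |β ^ 2 * ((∫ U, plaqCostAt ρ P.1 P.2.1.1 P.2.1.2 U * plaqCostAt ρ Q.1 Q.2.1.1 Q.2.1.2 U ∂(boxState ρ β ⌈β ^ θ⌉₊)) -
            (∫ U, plaqCostAt ρ P.1 P.2.1.1 P.2.1.2 U ∂(boxState ρ β ⌈β ^ θ⌉₊)) *
              (∫ U, plaqCostAt ρ Q.1 Q.2.1.1 Q.2.1.2 U ∂(boxState ρ β ⌈β ^ θ⌉₊))) -
          (dimE ρ : ℝ) / 2 *
            (∫ s, dirCirc ⌈β ^ θ⌉₊ (P.1, P.2.1.1, P.2.1.2) s * dirCirc ⌈β ^ θ⌉₊ (Q.1, Q.2.1.1, Q.2.1.2) s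
                ∂(boxDirichlet ⌈β ^ θ⌉₊)) ^ 2| ≤ β ^ (-(9 * θ)) := by
  obtain ⟨β₀, h⟩ := boxPairCovExpansion_of_rep ρ hρc hinj hρu hθ hθ1
  refine ⟨β₀, fun β hβ P Q hP hQ => ?_⟩
  have h1 := h β hβ P Q hP hQ
  rw [integral_dirCirc_sq_mul_sq_sub] at h1
  have e : (dimE ρ : ℝ) / 4 * (2 * (∫ s, dirCirc ⌈β ^ θ⌉₊ (P.1, P.2.1.1, P.2.1.2) s *
      dirCirc ⌈β ^ θ⌉₊ (Q.1, Q.2.1.1, Q.2.1.2) s ∂(boxDirichlet ⌈β ^ θ⌉₊)) ^ 2) =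
      (dimE ρ : ℝ) / 2 * (∫ s, dirCirc ⌈β ^ θ⌉₊ (P.1, P.2.1.1, P.2.1.2) s *
        dirCirc ⌈β ^ θ⌉₊ (Q.1, Q.2.1.1, Q.2.1.2) s ∂(boxDirichlet ⌈β ^ θ⌉₊)) ^ 2 := by ring
  rw [e] at h1
  exact h1

/-- **Every two-plaquette covariance of the cold box is nonnegative to leading order**: eventually in `β`, for all plaquettes `P, Q` touching
the box `H = ⌈β^θ⌉` (any two planes, any two positions), `(D/2)·E_D[s_P s_Q]² − β^{−9θ} ≤ β²·Cov_{boxState ρ β H}(c_P, c_Q)`; in particular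
`β²·Cov_{box}(c_P, c_Q) ≥ −β^{−9θ}`. -/
theorem boxPairCov_ge_of_rep (hρc : Continuous ρ) (hinj : Function.Injective ρ)
    (hρu : ∀ g, ρ g ∈ Matrix.unitaryGroup (Fin N) ℂ) {θ : ℝ} (hθ : 0 < θ) (hθ1 : θ ≤ 1 / 100) :
    ∃ β₀ : ℝ, ∀ β : ℝ, β₀ ≤ β → ∀ P Q : ZdPlaquette 4,
      P ∈ plaquettesTouching (boxEdges 4 (2 * ⌈β ^ θ⌉₊ + 1)) → Q ∈ plaquettesTouching (boxEdges 4 (2 * ⌈β ^ θ⌉₊ + 1)) →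
      (dimE ρ : ℝ) / 2 *
            (∫ s, dirCirc ⌈β ^ θ⌉₊ (P.1, P.2.1.1, P.2.1.2) s * dirCirc ⌈β ^ θ⌉₊ (Q.1, Q.2.1.1, Q.2.1.2) s
                ∂(boxDirichlet ⌈β ^ θ⌉₊)) ^ 2 - β ^ (-(9 * θ)) ≤
        β ^ 2 * ((∫ U, plaqCostAt ρ P.1 P.2.1.1 P.2.1.2 U * plaqCostAt ρ Q.1 Q.2.1.1 Q.2.1.2 U ∂(boxState ρ β ⌈β ^ θ⌉₊)) -
            (∫ U, plaqCostAt ρ P.1 P.2.1.1 P.2.1.2 U ∂(boxState ρ β ⌈β ^ θ⌉₊)) *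
              (∫ U, plaqCostAt ρ Q.1 Q.2.1.1 Q.2.1.2 U ∂(boxState ρ β ⌈β ^ θ⌉₊))) ∧
      -(β ^ (-(9 * θ))) ≤
        β ^ 2 * ((∫ U, plaqCostAt ρ P.1 P.2.1.1 P.2.1.2 U * plaqCostAt ρ Q.1 Q.2.1.1 Q.2.1.2 U ∂(boxState ρ β ⌈β ^ θ⌉₊)) -
            (∫ U, plaqCostAt ρ P.1 P.2.1.1 P.2.1.2 U ∂(boxState ρ β ⌈β ^ θ⌉₊)) *
              (∫ U, plaqCostAt ρ Q.1 Q.2.1.1 Q.2.1.2 U ∂(boxState ρ β ⌈β ^ θ⌉₊))) := by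
  obtain ⟨β₀, h⟩ := boxPairCovExpansion_wick_of_rep ρ hρc hinj hρu hθ hθ1
  refine ⟨β₀, fun β hβ P Q hP hQ => ?_⟩
  have h1 := (abs_le.1 (h β hβ P Q hP hQ)).1
  have hsq : 0 ≤ (dimE ρ : ℝ) / 2 *
      (∫ s, dirCirc ⌈β ^ θ⌉₊ (P.1, P.2.1.1, P.2.1.2) s * dirCirc ⌈β ^ θ⌉₊ (Q.1, Q.2.1.1, Q.2.1.2) s
        ∂(boxDirichlet ⌈β ^ θ⌉₊)) ^ 2 := by positivity
  constructor <;> linarith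

/-! ## The cold-box Gaussian floor for the corner action density -/

/-- **The cold-box Gaussian floor for the CORNER ACTION DENSITY, every compact group presented faithfully in `U(N)` with positive chart
dimension.**  For `0 < dimE ρ` and all `0 < A < θ ≤ 1/100` there is `c > 0` such that, eventually in `β`,
`c·C(⌈β^A⌉)² ≤ β²·Cov_{boxState ρ β ⌈β^θ⌉}(Σ_q c_{(x_c; q)}, Σ_q c_{(x_c + ⌈β^A⌉e₀; q)})`, the sums over the six planes `q = (μ < ν)`, `x_c` the box
centre, `C(n) = curvaturePlaquetteCorr 4 n` — the crux's `BoxTwoPointDomination` with the `(1,2)`-plaquette cost replaced by the six-plane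
corner density `Σ_{μ<ν}(N − Re tr ρ(U_{p_{μν}(x)}))`.  The `35` off-diagonal/other-diagonal plane pairs contribute `≥ −β^{−9θ}` each
(`boxPairCov_ge_of_rep`), the `(1,2)/(1,2)` pair the crux's floor (`boxTwoPointDomination_of_dimE_pos`), and `35β^{−9θ} ≤ (c/2)·C(⌈β^A⌉)²`
eventually since `9θ > 8A`. -/
theorem boxActionDensityTwoPointDomination_of_dimE_pos (hρc : Continuous ρ) (hinj : Function.Injective ρ)
    (hρu : ∀ g, ρ g ∈ Matrix.unitaryGroup (Fin N) ℂ) (hD : 0 < dimE ρ) {A θ : ℝ} (hA : 0 < A) (hAθ : A < θ)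
    (hθ1 : θ ≤ 1 / 100) :
    ∃ c : ℝ, 0 < c ∧ ∃ β₀ : ℝ, ∀ β : ℝ, β₀ ≤ β →
      c * curvaturePlaquetteCorr (d := 4) (by norm_num) (⌈β ^ A⌉₊ : ℤ) ^ 2 ≤
        β ^ 2 * ((∫ U, (∑ q : {q : Fin 4 × Fin 4 // q.1 < q.2}, plaqCostAt ρ (boxCentre ⌈β ^ θ⌉₊) q.1.1 q.1.2 U) *
              (∑ q : {q : Fin 4 × Fin 4 // q.1 < q.2},
                plaqCostAt ρ (boxCentre ⌈β ^ θ⌉₊ + Pi.single 0 (⌈β ^ A⌉₊ : ℤ)) q.1.1 q.1.2 U) ∂(boxState ρ β ⌈β ^ θ⌉₊)) -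
          (∫ U, ∑ q : {q : Fin 4 × Fin 4 // q.1 < q.2}, plaqCostAt ρ (boxCentre ⌈β ^ θ⌉₊) q.1.1 q.1.2 U ∂(boxState ρ β ⌈β ^ θ⌉₊)) *
            (∫ U, ∑ q : {q : Fin 4 × Fin 4 // q.1 < q.2},
                plaqCostAt ρ (boxCentre ⌈β ^ θ⌉₊ + Pi.single 0 (⌈β ^ A⌉₊ : ℤ)) q.1.1 q.1.2 U ∂(boxState ρ β ⌈β ^ θ⌉₊))) := by
  haveI : SecondCountableTopology (Matrix (Fin N) (Fin N) ℂ) := inferInstanceAs (SecondCountableTopology (Fin N → Fin N → ℂ))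
  haveI : SecondCountableTopology G := (hρc.isClosedEmbedding hinj).isEmbedding.secondCountableTopology
  have hθ : 0 < θ := hA.trans hAθ
  obtain ⟨c, hc, β₁, h₁⟩ := boxTwoPointDomination_of_dimE_pos ρ hρc hinj hρu hD hA hAθ hθ1
  obtain ⟨β₂, h₂⟩ := boxPairCov_ge_of_rep ρ hρc hinj hρu hθ hθ1
  obtain ⟨K_C, hKC0, hC⟩ := exists_curvaturePlaquetteCorr_asymp
  obtain ⟨β₃, hβ₃1, h₃⟩ := rpow_neg_mul_pow_le_eventually (A := A) (κ := 9 * θ) (by linarith)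
    (by positivity : (0 : ℝ) < c / 2 * (1 / (4 * π ^ 4)) / 35)
  have hθA : 0 < θ - A := by linarith
  set L : ℝ := 2 * π ^ 2 * K_C + 1 with hL
  have hKC2 : 0 ≤ 2 * π ^ 2 * K_C := by positivity
  have hL1 : 1 ≤ L := by linarith
  refine ⟨c / 2, by positivity, max (max β₁ β₂) (max β₃ (max ((3 : ℝ) ^ (1 / (θ - A))) (L ^ (1 / A)))), fun β hβ => ?_⟩
  have hb₁ : β₁ ≤ β := le_trans (le_trans (le_max_left _ _) (le_max_left _ _)) hβ
  have hb₂ : β₂ ≤ β := le_trans (le_trans (le_max_right _ _) (le_max_left _ _)) hβ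
  have hb₃ : β₃ ≤ β := le_trans (le_trans (le_max_left _ _) (le_max_right _ _)) hβ
  have hβ1 : 1 ≤ β := hβ₃1.trans hb₃
  have hβpos : 0 < β := by linarith
  have hdiff : (3 : ℝ) ≤ β ^ (θ - A) :=
    le_rpow_of_root_le (by norm_num) hθA (le_trans (le_trans (le_trans (le_max_left _ _) (le_max_right _ _)) (le_max_right _ _)) hβ)
  have hApow : L ≤ β ^ A :=
    le_rpow_of_root_le (by positivity) hA (le_trans (le_trans (le_trans (le_max_right _ _) (le_max_right _ _)) (le_max_right _ _)) hβ)
  have hA1 : 1 ≤ β ^ A := hL1.trans hApow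
  have hT_ge : β ^ A ≤ (⌈β ^ A⌉₊ : ℝ) := Nat.le_ceil _
  have hT_lt : (⌈β ^ A⌉₊ : ℝ) < β ^ A + 1 := Nat.ceil_lt_add_one (by positivity)
  have hT_le : (⌈β ^ A⌉₊ : ℝ) ≤ 2 * β ^ A := by linarith
  have hH_ge : β ^ θ ≤ (⌈β ^ θ⌉₊ : ℝ) := Nat.le_ceil _
  have hT1 : 1 ≤ ⌈β ^ A⌉₊ := by
    have : (1 : ℝ) ≤ ⌈β ^ A⌉₊ := hA1.trans hT_ge
    exact_mod_cast this
  have hT0 : (0 : ℝ) < ⌈β ^ A⌉₊ := by exact_mod_cast hT1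
  -- `T + 1 ≤ H`: `β^θ = β^{θ−A} β^A ≥ 3 β^A ≥ β^A + 2`
  have hsplit : β ^ θ = β ^ (θ - A) * β ^ A := by
    rw [← Real.rpow_add hβpos]; ring_nf
  have hTH : ⌈β ^ A⌉₊ + 1 ≤ ⌈β ^ θ⌉₊ := by
    have h3 : 3 * β ^ A ≤ β ^ θ := by rw [hsplit]; exact mul_le_mul_of_nonneg_right hdiff (by positivity)
    have : (⌈β ^ A⌉₊ : ℝ) + 1 ≤ ⌈β ^ θ⌉₊ := by linarith
    exact_mod_cast this
  have hH1 : 1 ≤ ⌈β ^ θ⌉₊ := le_trans (Nat.le_add_left 1 _) hTH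
  -- the curvature number and its lower bound
  set Cn := @Literature.MathematicalPhysics.QuantumFieldTheory.curvaturePlaquetteCorr 4 (by norm_num) (⌈β ^ A⌉₊ : ℤ) with hCn
  have hasy := hC ⌈β ^ A⌉₊ hT1
  have hClow : (1 / π ^ 2 / (⌈β ^ A⌉₊ : ℝ) ^ 4) / 2 ≤ Cn := by
    have hLT : L ≤ (⌈β ^ A⌉₊ : ℝ) := hApow.trans hT_ge
    have hKT : 2 * π ^ 2 * K_C ≤ (⌈β ^ A⌉₊ : ℝ) := by linarith
    have hCT : K_C / (⌈β ^ A⌉₊ : ℝ) ^ 5 ≤ (1 / π ^ 2 / (⌈β ^ A⌉₊ : ℝ) ^ 4) / 2 := by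
      have e : (1 / π ^ 2 / (⌈β ^ A⌉₊ : ℝ) ^ 4) / 2 = 1 / (2 * π ^ 2) / (⌈β ^ A⌉₊ : ℝ) ^ 4 := by field_simp
      rw [e, div_le_div_iff₀ (by positivity) (by positivity)]
      calc K_C * (⌈β ^ A⌉₊ : ℝ) ^ 4 = (2 * π ^ 2 * K_C) * (⌈β ^ A⌉₊ : ℝ) ^ 4 * (1 / (2 * π ^ 2)) := by field_simp
        _ ≤ (⌈β ^ A⌉₊ : ℝ) * (⌈β ^ A⌉₊ : ℝ) ^ 4 * (1 / (2 * π ^ 2)) := by gcongr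
        _ = 1 / (2 * π ^ 2) * (⌈β ^ A⌉₊ : ℝ) ^ 5 := by ring
    rw [abs_le] at hasy; linarith [hasy.1]
  have hC2 : 1 / (4 * π ^ 4) / (2 * β ^ A) ^ (8 : ℕ) ≤ Cn ^ 2 := by
    have hsq := pow_le_pow_left₀ (by positivity) hClow 2
    have hT8 : (⌈β ^ A⌉₊ : ℝ) ^ 8 ≤ (2 * β ^ A) ^ (8 : ℕ) := pow_le_pow_left₀ hT0.le hT_le 8
    calc 1 / (4 * π ^ 4) / (2 * β ^ A) ^ (8 : ℕ) ≤ 1 / (4 * π ^ 4) / (⌈β ^ A⌉₊ : ℝ) ^ 8 :=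
          div_le_div_of_nonneg_left (by positivity) (by positivity) hT8
      _ = ((1 / π ^ 2 / (⌈β ^ A⌉₊ : ℝ) ^ 4) / 2) ^ 2 := by field_simp; ring
      _ ≤ Cn ^ 2 := hsq
  -- `35 β^{−9θ} ≤ (c/2)·Cn²`
  have hsmall : 35 * β ^ (-(9 * θ)) ≤ c / 2 * Cn ^ 2 := by
    have e4 := h₃ β hb₃
    have hden : (0 : ℝ) < (2 * β ^ A) ^ (8 : ℕ) := by positivity
    have h3 : β ^ (-(9 * θ)) ≤ c / 2 * (1 / (4 * π ^ 4)) / 35 / (2 * β ^ A) ^ (8 : ℕ) := by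
      rw [le_div_iff₀ hden]; exact e4
    calc 35 * β ^ (-(9 * θ)) ≤ 35 * (c / 2 * (1 / (4 * π ^ 4)) / 35 / (2 * β ^ A) ^ (8 : ℕ)) := by linarith
      _ = c / 2 * (1 / (4 * π ^ 4) / (2 * β ^ A) ^ (8 : ℕ)) := by field_simp
      _ ≤ c / 2 * Cn ^ 2 := mul_le_mul_of_nonneg_left hC2 (by positivity)
  -- the `(1,2)/(1,2)` term is the crux's floor; the other pairs are `≥ −β^{−9θ}`
  have hfloor : c * Cn ^ 2 ≤ β ^ 2 * boxPlaqCov ρ β ⌈β ^ θ⌉₊ ⌈β ^ A⌉₊ := h₁ β hb₁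
  rw [boxPlaqCov] at hfloor
  have hpair : ∀ q q' : {q : Fin 4 × Fin 4 // q.1 < q.2},
      -(β ^ (-(9 * θ))) ≤ β ^ 2 * ((∫ U, plaqCostAt ρ (boxCentre ⌈β ^ θ⌉₊) q.1.1 q.1.2 U *
          plaqCostAt ρ (boxCentre ⌈β ^ θ⌉₊ + Pi.single 0 (⌈β ^ A⌉₊ : ℤ)) q'.1.1 q'.1.2 U ∂(boxState ρ β ⌈β ^ θ⌉₊)) -
        (∫ U, plaqCostAt ρ (boxCentre ⌈β ^ θ⌉₊) q.1.1 q.1.2 U ∂(boxState ρ β ⌈β ^ θ⌉₊)) *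
          (∫ U, plaqCostAt ρ (boxCentre ⌈β ^ θ⌉₊ + Pi.single 0 (⌈β ^ A⌉₊ : ℤ)) q'.1.1 q'.1.2 U ∂(boxState ρ β ⌈β ^ θ⌉₊))) := by
    intro q q'
    obtain ⟨hPm, hQm⟩ := centre_pair_mem_plaquettesTouching hH1 hTH q q'
    exact (h₂ β hb₂ _ _ hPm hQm).2
  haveI : IsProbabilityMeasure (boxState ρ β ⌈β ^ θ⌉₊) := isProbabilityMeasure_ymSpecification _ hρc β _ _
  have hfin : IsFiniteMeasure (boxState ρ β ⌈β ^ θ⌉₊) := inferInstance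
  -- the six-plane bookkeeping (all arguments explicit: the implicit-argument unification through the 36-fold `∀` is costly)
  have hsum := @sq_mul_cov_planeSum_ge N G _ _ _ _ _ _ ρ (boxState ρ β ⌈β ^ θ⌉₊) hfin hρc hρu (boxCentre ⌈β ^ θ⌉₊)
    (boxCentre ⌈β ^ θ⌉₊ + Pi.single 0 (⌈β ^ A⌉₊ : ℤ)) β (β ^ (-(9 * θ))) (by intro q q'; exact hpair q q')
  linarith [hfloor, hsum, hsmall]

end Rep

/-! ## Every compact simple `G`, every faithful unitary lattice representation (the binder shape of the crux) -/

/-- **S2 for ALL plaquette pairs, every compact `G` and every faithful unitary lattice representation `r`** (Borel structure `borel G`; no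
simplicity needed): for `0 < θ ≤ 1/100`, eventually in `β`, for all plaquettes `P, Q` touching the box `H = ⌈β^θ⌉`,
`|β²·Cov_{boxState r.ρ β H}(c_P, c_Q) − (D/2)·E_D[s_P s_Q]²| ≤ β^{−9θ}`, `D = dimE r.ρ`. -/
theorem boxPairCovExpansion_allGroups :
    ∀ (G : Type) [Group G] [TopologicalSpace G] [IsTopologicalGroup G] [CompactSpace G],
    letI : MeasurableSpace G := borel G
    haveI : BorelSpace G := ⟨rfl⟩
    ∀ r : LatticeRep G, ∀ θ : ℝ, 0 < θ → θ ≤ 1 / 100 → ∃ β₀ : ℝ, ∀ β : ℝ, β₀ ≤ β → ∀ P Q : ZdPlaquette 4,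
      P ∈ plaquettesTouching (boxEdges 4 (2 * ⌈β ^ θ⌉₊ + 1)) → Q ∈ plaquettesTouching (boxEdges 4 (2 * ⌈β ^ θ⌉₊ + 1)) →
      |β ^ 2 * ((∫ U, plaqCostAt r.ρ P.1 P.2.1.1 P.2.1.2 U * plaqCostAt r.ρ Q.1 Q.2.1.1 Q.2.1.2 U ∂(boxState r.ρ β ⌈β ^ θ⌉₊)) -
            (∫ U, plaqCostAt r.ρ P.1 P.2.1.1 P.2.1.2 U ∂(boxState r.ρ β ⌈β ^ θ⌉₊)) *
              (∫ U, plaqCostAt r.ρ Q.1 Q.2.1.1 Q.2.1.2 U ∂(boxState r.ρ β ⌈β ^ θ⌉₊))) -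
          (dimE r.ρ : ℝ) / 2 *
            (∫ s, dirCirc ⌈β ^ θ⌉₊ (P.1, P.2.1.1, P.2.1.2) s * dirCirc ⌈β ^ θ⌉₊ (Q.1, Q.2.1.1, Q.2.1.2) s
                ∂(boxDirichlet ⌈β ^ θ⌉₊)) ^ 2| ≤ β ^ (-(9 * θ)) := by
  intro G _ _ _ _
  letI : MeasurableSpace G := borel G
  haveI : BorelSpace G := ⟨rfl⟩
  intro r θ hθ hθ1
  exact boxPairCovExpansion_wick_of_rep r.ρ r.continuous r.injective r.mem_unitary hθ hθ1

/-- **The cold-box Gaussian floor for the corner action density, every compact simple `G`** (tree sense `IsCompactSimpleLieGroup`, used only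
through `0 < dimE r.ρ`) **and every faithful unitary lattice representation `r`:** for all `0 < A < θ ≤ 1/100` there is `c > 0` with, eventually
in `β`, `c·C(⌈β^A⌉)² ≤ β²·Cov_{boxState r.ρ β ⌈β^θ⌉}(Σ_{μ<ν} c_{(x_c;μ,ν)}, Σ_{μ<ν} c_{(x_c + ⌈β^A⌉e₀;μ,ν)})` — the BOX statement of the crux
`BoxFloorAllGroups` for the six-plane density `Σ_{μ<ν}(N − Re tr r.ρ(U_{p_{μν}}))` (the species of the node `LatticeNonFreezing`, up to the
constant `6N` and translation).  NOT the Clay mass gap; the BULK transfer for this density is not claimed. -/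
theorem boxActionDensityFloor_allGroups :
    ∀ (G : Type) [Group G] [TopologicalSpace G] [IsTopologicalGroup G] [CompactSpace G],
    IsCompactSimpleLieGroup G →
    letI : MeasurableSpace G := borel G
    haveI : BorelSpace G := ⟨rfl⟩
    ∀ r : LatticeRep G, ∀ A θ : ℝ, 0 < A → A < θ → θ ≤ 1 / 100 → ∃ c : ℝ, 0 < c ∧ ∃ β₀ : ℝ, ∀ β : ℝ, β₀ ≤ β →
      c * curvaturePlaquetteCorr (d := 4) (by norm_num) (⌈β ^ A⌉₊ : ℤ) ^ 2 ≤
        β ^ 2 * ((∫ U, (∑ q : {q : Fin 4 × Fin 4 // q.1 < q.2}, plaqCostAt r.ρ (boxCentre ⌈β ^ θ⌉₊) q.1.1 q.1.2 U) *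
              (∑ q : {q : Fin 4 × Fin 4 // q.1 < q.2},
                plaqCostAt r.ρ (boxCentre ⌈β ^ θ⌉₊ + Pi.single 0 (⌈β ^ A⌉₊ : ℤ)) q.1.1 q.1.2 U) ∂(boxState r.ρ β ⌈β ^ θ⌉₊)) -
          (∫ U, ∑ q : {q : Fin 4 × Fin 4 // q.1 < q.2}, plaqCostAt r.ρ (boxCentre ⌈β ^ θ⌉₊) q.1.1 q.1.2 U
              ∂(boxState r.ρ β ⌈β ^ θ⌉₊)) *
            (∫ U, ∑ q : {q : Fin 4 × Fin 4 // q.1 < q.2},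
                plaqCostAt r.ρ (boxCentre ⌈β ^ θ⌉₊ + Pi.single 0 (⌈β ^ A⌉₊ : ℤ)) q.1.1 q.1.2 U ∂(boxState r.ρ β ⌈β ^ θ⌉₊))) := by
  intro G _ _ _ _ hG
  letI : MeasurableSpace G := borel G
  haveI : BorelSpace G := ⟨rfl⟩
  intro r A θ hA hAθ hθ1
  exact boxActionDensityTwoPointDomination_of_dimE_pos r.ρ r.continuous r.injective r.mem_unitary
    (Summit.QuantumFields.YangMills.Cruxes.NT.LinkEquipartition.dimE_pos_of_isCompactSimpleLieGroup G r hG) hA hAθ hθ1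

end Summit.QuantumFields.YangMills.Theorems.ColdBoxAllGroups

end
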